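import Summits.Ventures.LatticeQCDFlow.Exactness.IMHVariationalBound
import HarnessLib

/-!
# The acceptance-weighted ceiling: `τ_int(g) ≤ E_{g²w}[1/ρ]/ā − ½` for the exact flow sampler

HONEST FRAMING: exact (Metropolis-corrected) sampling algorithms for lattice gauge theory;
figures of merit are autocorrelation/cost numbers at stated couplings and volumes; no
continuum-physics claim.  (SCALAR calibration rung S0-A: not a gauge result.)

Venture `LatticeQCDFlow` (cell pub-lqcd), topic `Exactness`; FANOUT row 2 (`s0-phi4`, FLOW arm).
NEW WORK of the cell: a ceiling on the integrated autocorrelation time of every bounded observable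
of the exact flow sampler in terms of TWO MEASURED columns — the equilibrium acceptance `ā` and
the `g²`-weighted mean of the inverse per-state acceptance `1/ρ` (`ρ(t) = 1 − λ(b(t))`, a
function of the importance weight, estimable from i.i.d. model draws).  Printed counterpart NAMED
ONLY: Deligiannidis–Lee 2018, Ann. Appl. Probab. 28, §3 Prop. (`var(f,P) ≤ 2π̃(f²/ρ²) − π(f²)`,
via the jump chain of Doucet et al. 2015, Kipnis–Varadhan and a variational formula)
[corpus: paper:arxiv-1606.08373 p.8].  The route here is elementary and self-contained over the
tree: the variational inequality `Σ_{k≤N} C(k) ≤ 2⟨g, v_N⟩ − 𝓔(v_N)` for the partial Neumann sums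
`v_N = Σ_{k≤N} Kᵏ g` (all autocovariances `≥ 0`), and the Poincaré-type bound of
`IMHDirichletForm.lean` (`𝓔(v) ≥ ā·Var_{ρw}(v)`, from the rank-one minorant
`s(t,t') ≥ ρρ'ww'/Z`) closed by a pointwise AM–GM.

## What is proved (`w, q > 0` measurable integrable, `∫ q = 1`, `Z = ∫ w`, `b = w/q`,
`W₂ = ∫ b w < ∞`, `ρ(t) = 1 − λ(b(t))`, `ā = ∫ ρ w / Z`; `g` measurable, `|g| ≤ B`, `∫ g w = 0`;
`K = imhOp μ w q`, `C(k) = ∫ g (Kᵏ g) w`)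

* (inputs, `IMHVariationalBound.lean`: `two_inner_sub_dirichlet_le`, `dirichlet_neumannSum_le`)
* **`partialSum_autocov_le_acceptanceCeiling`** — `Σ_{k≤N} C(k) ≤ (∫ g² w/ρ) Z/∫ρw` for all `N`;
* **`tsum_autocov_le_acceptanceCeiling`** — the series is summable (a third, independent proof of
  `W₂ < ∞ ⇒` summability) with `Σ_{k≥1} C(k) ≤ (∫ g² w/ρ) Z/∫ρw − ∫ g² w`;
* **`imhOp_tauInt_le_acceptanceCeiling`** — for `∫ g² w > 0`, on `Scoring.tauInt`:
  `τ_int(g) ≤ (∫ g² w/ρ)/(ā ∫ g² w) − ½ = E_{g²w}[1/ρ]/ā − ½`;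
* `imhOp_tauInt_le_acceptanceESS` — the i.i.d.-estimable corollary
  `τ_int(g) ≤ (W₂/Z² + ∫g²wb/(Z∫g²w))/ā − ½ = (1/κ + E_{g²w}[b]/Z)/ā − ½`;
* the lattice (row 2's `imhOpPhi4 J λ q̃`, `g = f − ⟨f⟩`): **`phi4Flow_tauInt_le_acceptanceCeiling`**.

Reading for S0-A (no numerics implied): with `1/ρ ≤ 1/κ + b/Z` (`IMHAcceptanceGeHalfESS`) and
`ā ≥ κ/2` this implies the κ-only bounds, but it is much sharper whenever `ā` is measured: e.g.
`ā = ½`, `E_{g²}[1/ρ] = 3` give `τ_int ≤ 5.5`.  On random finite examples (seat folder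
`analysis/check_I_bound.py`, stdlib python) the ceiling exceeds the exact `τ_int` by factors 2–6
where the κ-only bound of `IMHTauIntLeInvESS` exceeds it by 30–1000.
NOT CLAIMED: sharpness; HMC / local Metropolis; unbounded observables; any number for a trained
network.
-/

namespace Summit.Ventures.LatticeQCDFlow.Exactness

open Real MeasureTheory Filter Set Topology
open Summit.Ventures.LatticeQCDFlow.Scoring

variable {X : Type*} [MeasurableSpace X] {μ : Measure X} {w q : X → ℝ}

variable [SFinite μ]

/-- **UNIFORM BOUND ON THE PARTIAL GREEN–KUBO SUMS**: for every `N`,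
`Σ_{k≤N} C(k) ≤ (∫ g² w/ρ) · Z/∫ ρ w` (variational bound at `v = v_N`). -/
theorem partialSum_autocov_le_acceptanceCeiling (hw0 : ∀ t, 0 < w t) (hwm : Measurable w)
    (hwi : Integrable w μ) (hq0 : ∀ t, 0 < q t) (hqm : Measurable q) (hqi : Integrable q μ)
    (hq1 : ∫ z, q z ∂μ = 1) (hW₂ : Integrable (fun x => w x / q x * w x) μ) {g : X → ℝ}
    (hgm : Measurable g) {B : ℝ} (hgb : ∀ t, |g t| ≤ B) (hg0 : ∫ x, g x * w x ∂μ = 0) (N : ℕ) :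
    ∑ k ∈ Finset.range (N + 1), ∫ t, g t * ((imhOp μ w q)^[k] g) t * w t ∂μ
      ≤ (∫ t, g t ^ 2 * w t / (1 - rejCurve μ w q (w t / q t)) ∂μ)
          * ((∫ z, w z ∂μ) / ∫ t, (1 - rejCurve μ w q (w t / q t)) * w t ∂μ) := by
  obtain ⟨hm, hb, -⟩ := neumannSum_facts hw0 hwm hq0 hqm hqi hq1 hgm hgb N
  have hvar := two_inner_sub_dirichlet_le hw0 hwm hwi hq0 hqm hqi hq1 hW₂ hgm hgb hg0 hm hb
  have hdir := dirichlet_neumannSum_le hw0 hwm hwi hq0 hqm hqi hq1 hgm hgb N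
  -- `∫ g v_N w = Σ_k C(k)`
  have hterm : ∀ k, Integrable (fun t => g t * ((imhOp μ w q)^[k] g) t * w t) μ := fun k => by
    obtain ⟨hkm, hkb⟩ := imhOp_iterate_bdd (μ := μ) hw0 hwm hq0 hqm hqi hq1 k hgm hgb
    exact integrable_mul_mul_weight hw0 hwm hwi hgm hkm hgb hkb
  have hinner : ∫ t, g t * (∑ k ∈ Finset.range (N + 1), ((imhOp μ w q)^[k] g) t) * w t ∂μ
      = ∑ k ∈ Finset.range (N + 1), ∫ t, g t * ((imhOp μ w q)^[k] g) t * w t ∂μ := by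
    rw [← integral_finsetSum _ fun k _ => hterm k]
    refine integral_congr_ae (Eventually.of_forall fun t => ?_)
    show g t * (∑ k ∈ Finset.range (N + 1), ((imhOp μ w q)^[k] g) t) * w t
      = ∑ k ∈ Finset.range (N + 1), g t * ((imhOp μ w q)^[k] g) t * w t
    rw [Finset.mul_sum, Finset.sum_mul]
  rw [hinner] at hvar
  linarith

/-- **THE GREEN–KUBO SUM UNDER THE ACCEPTANCE-WEIGHTED CEILING**: the autocovariance series of
a bounded centred `g` is summable and `Σ_{k≥1} C(k) ≤ (∫ g² w/ρ) Z/∫ρw − ∫ g² w`. -/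
theorem tsum_autocov_le_acceptanceCeiling (hw0 : ∀ t, 0 < w t) (hwm : Measurable w)
    (hwi : Integrable w μ) (hq0 : ∀ t, 0 < q t) (hqm : Measurable q) (hqi : Integrable q μ)
    (hq1 : ∫ z, q z ∂μ = 1) (hW₂ : Integrable (fun x => w x / q x * w x) μ) {g : X → ℝ}
    (hgm : Measurable g) {B : ℝ} (hgb : ∀ t, |g t| ≤ B) (hg0 : ∫ x, g x * w x ∂μ = 0) :
    Summable (fun k => ∫ t, g t * ((imhOp μ w q)^[k + 1] g) t * w t ∂μ)
    ∧ ∑' k, ∫ t, g t * ((imhOp μ w q)^[k + 1] g) t * w t ∂μ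
      ≤ (∫ t, g t ^ 2 * w t / (1 - rejCurve μ w q (w t / q t)) ∂μ)
          * ((∫ z, w z ∂μ) / ∫ t, (1 - rejCurve μ w q (w t / q t)) * w t ∂μ)
        - ∫ t, g t ^ 2 * w t ∂μ := by
  set C : ℕ → ℝ := fun k => ∫ t, g t * ((imhOp μ w q)^[k] g) t * w t ∂μ with hCdef
  have hC0 : C 0 = ∫ t, g t ^ 2 * w t ∂μ := by
    simp only [hCdef, Function.iterate_zero, id_eq]
    refine integral_congr_ae (Eventually.of_forall fun t => ?_)
    show g t * g t * w t = g t ^ 2 * w t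
    ring
  have hCnn : ∀ k, 0 ≤ C k := fun k => autocov_nonneg hw0 hwm hwi hq0 hqm hqi hq1 hgm hgb k
  have hbound : ∀ N, ∑ k ∈ Finset.range N, C (k + 1)
      ≤ (∫ t, g t ^ 2 * w t / (1 - rejCurve μ w q (w t / q t)) ∂μ)
          * ((∫ z, w z ∂μ) / ∫ t, (1 - rejCurve μ w q (w t / q t)) * w t ∂μ)
        - ∫ t, g t ^ 2 * w t ∂μ := by
    intro N
    have h := partialSum_autocov_le_acceptanceCeiling hw0 hwm hwi hq0 hqm hqi hq1 hW₂ hgm hgb hg0 N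
    rw [Finset.sum_range_succ'] at h
    change (∑ k ∈ Finset.range N, C (k + 1)) + C 0 ≤ _ at h
    rw [hC0] at h
    linarith
  have hs : Summable (fun k => C (k + 1)) :=
    summable_of_sum_range_le (fun k => hCnn (k + 1)) hbound
  exact ⟨hs, hs.tsum_le_of_sum_range_le hbound⟩

/-- **THE ACCEPTANCE-WEIGHTED CEILING ON `τ_int`.**  `w, q > 0` measurable integrable, `∫ q = 1`,
`Z = ∫ w`, `b = w/q` with `∫ b w < ∞`; `ρ(t) = 1 − λ(b(t))` the acceptance probability from `t`,
`ā = (∫ ρ w)/Z` the equilibrium acceptance; `g` measurable, `|g| ≤ B`, `∫ g w = 0`,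
`∫ g² w > 0`.  On `Scoring.tauInt`:
`τ_int(g) ≤ (∫ g² w/ρ dμ) / (ā ∫ g² w dμ) − ½ = E_{g²w}[1/ρ]/ā − ½`
(Deligiannidis–Lee 2018 Prop., named only; proved here without the jump chain or spectral
theory). -/
theorem imhOp_tauInt_le_acceptanceCeiling (hw0 : ∀ t, 0 < w t) (hwm : Measurable w)
    (hwi : Integrable w μ) (hq0 : ∀ t, 0 < q t) (hqm : Measurable q) (hqi : Integrable q μ)
    (hq1 : ∫ z, q z ∂μ = 1) (hW₂ : Integrable (fun x => w x / q x * w x) μ) {g : X → ℝ}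
    (hgm : Measurable g) {B : ℝ} (hgb : ∀ t, |g t| ≤ B) (hg0 : ∫ x, g x * w x ∂μ = 0)
    (hA : 0 < ∫ t, g t ^ 2 * w t ∂μ) :
    tauInt (fun k => (∫ t, g t * ((imhOp μ w q)^[k] g) t * w t ∂μ) / ∫ t, g t ^ 2 * w t ∂μ)
      ≤ (∫ t, g t ^ 2 * w t / (1 - rejCurve μ w q (w t / q t)) ∂μ)
          / (((∫ t, (1 - rejCurve μ w q (w t / q t)) * w t ∂μ) / ∫ z, w z ∂μ) * ∫ t, g t ^ 2 * w t ∂μ)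
        - 1 / 2 := by
  obtain ⟨hs, htsum⟩ := tsum_autocov_le_acceptanceCeiling hw0 hwm hwi hq0 hqm hqi hq1 hW₂ hgm hgb hg0
  set A : ℝ := ∫ t, g t ^ 2 * w t ∂μ with hAdef
  set Z : ℝ := ∫ z, w z ∂μ with hZdef
  set P : ℝ := ∫ t, (1 - rejCurve μ w q (w t / q t)) * w t ∂μ with hPdef
  set G₂ : ℝ := ∫ t, g t ^ 2 * w t / (1 - rejCurve μ w q (w t / q t)) ∂μ with hG₂
  have hZ : 0 < Z := integral_pos_of_pos hw0 hwi hq1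
  have hρm : Measurable (fun t => 1 - rejCurve μ w q (w t / q t)) :=
    measurable_const.sub ((measurable_rejCurve hwm hqm).comp (hwm.div hqm))
  have hρb : ∀ t, |1 - rejCurve μ w q (w t / q t)| ≤ 1 := fun t => by
    obtain ⟨-, h0, h1⟩ := acc_mul_weight_le hw0 hwm hwi hq0 hqm hqi hq1 t
    rw [abs_of_pos h0]; exact h1
  have h1b : ∀ t : X, |(fun _ : X => (1:ℝ)) t| ≤ 1 := fun _ => by simp
  have hPi : Integrable (fun t => (1 - rejCurve μ w q (w t / q t)) * w t) μ :=
    (integrable_mul_mul_weight hw0 hwm hwi hρm measurable_const hρb h1b).congr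
      (Eventually.of_forall fun t => by simp)
  have hP : 0 < P := integral_pos_of_pos (fun t => mul_pos
    (acc_mul_weight_le hw0 hwm hwi hq0 hqm hqi hq1 t).2.1 (hw0 t)) hPi hq1
  simp only [tauInt]
  change 1 / 2 + ∑' k, (∫ t, g t * ((imhOp μ w q)^[k + 1] g) t * w t ∂μ) / A ≤ G₂ / (P / Z * A) - 1 / 2
  rw [tsum_div_const, ← sub_nonneg]
  have e : G₂ / (P / Z * A) - 1 / 2
        - (1 / 2 + (∑' k, ∫ t, g t * ((imhOp μ w q)^[k + 1] g) t * w t ∂μ) / A)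
      = (G₂ * (Z / P) - A - ∑' k, ∫ t, g t * ((imhOp μ w q)^[k + 1] g) t * w t ∂μ) / A := by
    have hPne := hP.ne'
    have hZne := hZ.ne'
    have hAne := hA.ne'
    field_simp
    ring
  rw [e]
  exact div_nonneg (by linarith) hA.le



/-- **Corollary in i.i.d.-estimable form**: since `1/ρ ≤ 1/κ + b/Z` (`IMHAcceptanceGeHalfESS`),
`τ_int(g) ≤ (1/κ + E_{g²w}[b]/Z) / ā − ½`, i.e. with `W₂ = ∫ b w`, `A = ∫ g² w`:
`τ_int(g) ≤ (W₂/Z² + (∫ g² w b)/(Z A)) / ā − ½`. -/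
theorem imhOp_tauInt_le_acceptanceESS (hw0 : ∀ t, 0 < w t) (hwm : Measurable w)
    (hwi : Integrable w μ) (hq0 : ∀ t, 0 < q t) (hqm : Measurable q) (hqi : Integrable q μ)
    (hq1 : ∫ z, q z ∂μ = 1) (hW₂ : Integrable (fun x => w x / q x * w x) μ) {g : X → ℝ}
    (hgm : Measurable g) {B : ℝ} (hgb : ∀ t, |g t| ≤ B) (hg0 : ∫ x, g x * w x ∂μ = 0)
    (hA : 0 < ∫ t, g t ^ 2 * w t ∂μ) :
    tauInt (fun k => (∫ t, g t * ((imhOp μ w q)^[k] g) t * w t ∂μ) / ∫ t, g t ^ 2 * w t ∂μ)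
      ≤ ((∫ z, w z / q z * w z ∂μ) / (∫ z, w z ∂μ) ^ 2
          + (∫ t, g t ^ 2 * w t * (w t / q t) ∂μ) / ((∫ z, w z ∂μ) * ∫ t, g t ^ 2 * w t ∂μ))
          / ((∫ t, (1 - rejCurve μ w q (w t / q t)) * w t ∂μ) / ∫ z, w z ∂μ)
        - 1 / 2 := by
  have h := imhOp_tauInt_le_acceptanceCeiling hw0 hwm hwi hq0 hqm hqi hq1 hW₂ hgm hgb hg0 hA
  refine h.trans ?_
  set A : ℝ := ∫ t, g t ^ 2 * w t ∂μ with hAdef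
  set Z : ℝ := ∫ z, w z ∂μ with hZdef
  set W : ℝ := ∫ z, w z / q z * w z ∂μ with hWdef
  set P : ℝ := ∫ t, (1 - rejCurve μ w q (w t / q t)) * w t ∂μ with hPdef
  have hZ : 0 < Z := integral_pos_of_pos hw0 hwi hq1
  have hb0 : ∀ t, 0 < w t / q t := fun t => div_pos (hw0 t) (hq0 t)
  have hP : 0 < P := by
    have hρm : Measurable (fun t => 1 - rejCurve μ w q (w t / q t)) :=
      measurable_const.sub ((measurable_rejCurve hwm hqm).comp (hwm.div hqm))
    have hρb : ∀ t, |1 - rejCurve μ w q (w t / q t)| ≤ 1 := fun t => by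
      obtain ⟨-, h0, h1⟩ := acc_mul_weight_le hw0 hwm hwi hq0 hqm hqi hq1 t
      rw [abs_of_pos h0]; exact h1
    have h1b : ∀ t : X, |(fun _ : X => (1:ℝ)) t| ≤ 1 := fun _ => by simp
    have hPi : Integrable (fun t => (1 - rejCurve μ w q (w t / q t)) * w t) μ :=
      (integrable_mul_mul_weight hw0 hwm hwi hρm measurable_const hρb h1b).congr
        (Eventually.of_forall fun t => by simp)
    exact integral_pos_of_pos (fun t => mul_pos
      (acc_mul_weight_le hw0 hwm hwi hq0 hqm hqi hq1 t).2.1 (hw0 t)) hPi hq1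
  -- `∫ g² w/ρ ≤ (W/Z²) A + (1/Z) ∫ g² w b`
  have hg2 : ∀ t, g t ^ 2 ≤ B ^ 2 := fun t => by
    rw [← sq_abs]; exact pow_le_pow_left₀ (abs_nonneg _) (hgb t) 2
  have hgbw : Integrable (fun t => g t ^ 2 * w t * (w t / q t)) μ := by
    refine Integrable.mono' (hW₂.const_mul (B ^ 2)) (((hgm.pow_const 2).mul hwm).mul
      (hwm.div hqm)).aestronglyMeasurable (Eventually.of_forall fun t => ?_)
    have h0 : 0 ≤ w t * (w t / q t) := mul_nonneg (hw0 t).le (hb0 t).le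
    rw [Real.norm_eq_abs, abs_of_nonneg (mul_nonneg (mul_nonneg (sq_nonneg _) (hw0 t).le) (hb0 t).le)]
    calc g t ^ 2 * w t * (w t / q t) = g t ^ 2 * (w t * (w t / q t)) := by ring
      _ ≤ B ^ 2 * (w t * (w t / q t)) := mul_le_mul_of_nonneg_right (hg2 t) h0
      _ = B ^ 2 * (w t / q t * w t) := by ring
  have hg2w : Integrable (fun t => g t ^ 2 * w t) μ :=
    (integrable_sq_mul_weight_mul hw0 hwm hwi hgm measurable_const hgb (fun _ => zero_le_one)
      (fun _ => le_rfl)).congr (Eventually.of_forall fun t => mul_one _)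
  have hG₂le : ∫ t, g t ^ 2 * w t / (1 - rejCurve μ w q (w t / q t)) ∂μ
      ≤ W / Z ^ 2 * A + (1 / Z) * ∫ t, g t ^ 2 * w t * (w t / q t) ∂μ := by
    rw [hAdef, ← integral_const_mul, ← integral_const_mul, ← integral_add (hg2w.const_mul _)
      (hgbw.const_mul _)]
    refine integral_mono (integrable_sq_mul_weight_div_acc hw0 hwm hwi hq0 hqm hqi hq1 hW₂ hgm hgb)
      ((hg2w.const_mul _).add (hgbw.const_mul _)) fun t => ?_
    have hρ := one_sub_rejCurve_ge hw0 hwm hwi hq0 hqm hqi hq1 hW₂ (hb0 t)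
    rw [← hZdef, ← hWdef] at hρ
    have hden : 0 < W + w t / q t * Z :=
      add_pos_of_nonneg_of_pos (integral_nonneg fun z => mul_nonneg (hb0 z).le (hw0 z).le)
        (mul_pos (hb0 t) hZ)
    show g t ^ 2 * w t / (1 - rejCurve μ w q (w t / q t))
      ≤ W / Z ^ 2 * (g t ^ 2 * w t) + 1 / Z * (g t ^ 2 * w t * (w t / q t))
    calc g t ^ 2 * w t / (1 - rejCurve μ w q (w t / q t))
        ≤ g t ^ 2 * w t / (Z ^ 2 / (W + w t / q t * Z)) :=
          div_le_div_of_nonneg_left (mul_nonneg (sq_nonneg _) (hw0 t).le)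
            (div_pos (pow_pos hZ 2) hden) hρ
      _ = W / Z ^ 2 * (g t ^ 2 * w t) + 1 / Z * (g t ^ 2 * w t * (w t / q t)) := by
          field_simp
  -- divide by `(P/Z) A > 0` and compare
  have hPA : 0 < P / Z * A := mul_pos (div_pos hP hZ) hA
  have step : (∫ t, g t ^ 2 * w t / (1 - rejCurve μ w q (w t / q t)) ∂μ) / (P / Z * A)
      ≤ (W / Z ^ 2 * A + (1 / Z) * ∫ t, g t ^ 2 * w t * (w t / q t) ∂μ) / (P / Z * A) :=
    div_le_div_of_nonneg_right hG₂le hPA.le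
  have e : (W / Z ^ 2 * A + (1 / Z) * ∫ t, g t ^ 2 * w t * (w t / q t) ∂μ) / (P / Z * A)
      = (W / Z ^ 2 + (∫ t, g t ^ 2 * w t * (w t / q t) ∂μ) / (Z * A)) / (P / Z) := by
    have hZne := hZ.ne'
    have hPne := hP.ne'
    have hAne := hA.ne'
    field_simp
  rw [e] at step
  linarith

/-! ## The lattice: row 2's φ⁴ flow sampler -/

section Lattice

variable {n : ℕ}

/-- **ACCEPTANCE-WEIGHTED CEILING FOR THE φ⁴ FLOW SAMPLER**: every `λ > 0`, real `J`, positive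
measurable model density `q̃` with `∫ q̃ = 1` and `∫ (e^{−S}/q̃) e^{−S} < ∞`; `f` bounded measurable
with `g = f − ⟨f⟩` of positive variance; `ρ(φ) = 1 − λ(e^{−S(φ)}/q̃(φ))` the acceptance probability
from `φ`, `Z = ∫ e^{−S}`.  Then
`τ_int(f) ≤ (∫ g² e^{−S}/ρ) / ((∫ ρ e^{−S}/Z) ∫ g² e^{−S}) − ½`. -/
theorem phi4Flow_tauInt_le_acceptanceCeiling {lam : ℝ} (hlam : 0 < lam)
    (J : Fin (n + 1) → Fin (n + 1) → ℝ) {q : (Fin (n + 1) → ℝ) → ℝ} (hq0 : ∀ φ, 0 < q φ)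
    (hqm : Measurable q) (hqi : Integrable q) (hq1 : ∫ φ, q φ = 1)
    (hW₂ : Integrable (fun φ => gibbsWeight J lam φ / q φ * gibbsWeight J lam φ))
    {f : (Fin (n + 1) → ℝ) → ℝ} (hfm : Measurable f) {B : ℝ} (hfb : ∀ φ, |f φ| ≤ B)
    (hA : 0 < ∫ φ, (f φ - gibbsExpect J lam f) ^ 2 * gibbsWeight J lam φ) :
    tauInt (fun k => (∫ φ, (f φ - gibbsExpect J lam f)
        * ((imhOpPhi4 J lam q)^[k] (fun ψ => f ψ - gibbsExpect J lam f)) φ * gibbsWeight J lam φ)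
        / ∫ φ, (f φ - gibbsExpect J lam f) ^ 2 * gibbsWeight J lam φ)
      ≤ (∫ φ, (f φ - gibbsExpect J lam f) ^ 2 * gibbsWeight J lam φ
            / (1 - rejCurve volume (gibbsWeight J lam) q (gibbsWeight J lam φ / q φ)))
          / (((∫ φ, (1 - rejCurve volume (gibbsWeight J lam) q (gibbsWeight J lam φ / q φ))
                * gibbsWeight J lam φ) / ∫ φ, gibbsWeight J lam φ)
            * ∫ φ, (f φ - gibbsExpect J lam f) ^ 2 * gibbsWeight J lam φ)
        - 1 / 2 := by
  obtain ⟨hgm, hgb, hg0⟩ := centred_observable hlam J hfm hfb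
  rw [imhOpPhi4_eq_imhOp]
  exact imhOp_tauInt_le_acceptanceCeiling (μ := volume) (fun ψ => gibbsWeight_pos J lam ψ)
    (continuous_gibbsWeight J lam).measurable (integrable_gibbsWeight hlam J) hq0 hqm hqi hq1
    hW₂ hgm hgb hg0 hA

end Lattice

end Summit.Ventures.LatticeQCDFlow.Exactness
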